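import Mathlib
import Summits.Ventures.PercRepro2.HCov
import Summits.Ventures.PercRepro2.HCovCubic
import Summits.Ventures.PercRepro2.TriDisagreement
import Summits.Ventures.PercRepro2.TriDisagreementPinned
import Summits.Ventures.PercRepro2.TypedSplit
import Summits.Ventures.PercRepro2.OneTypedEdge
import Summits.Ventures.PercRepro2.TypedSeries
import Summits.Ventures.PercRepro2.StarPattern
import Summits.Ventures.PercRepro2.StarIdentities

/-!
# The pair bases of a star are typed counts of the graph itself (blind cell PercRepro2, p1 g12;
the graph-row reading of the one-rung objects after NEG-108, part I: the type-1 pair bases)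

A PAIR block `{s_i, s_j}` of the star at `y` open in a copy is `y` as a series vertex between
`u_i` and `u_j`; pinning `s_j` OPEN (in every copy) and typing `s_i` realises the pair base as a
typed count of the graph `G` itself on the minor `(insert s_i F₀, z₀[s_j ↦ open])`: in the copies
where `s_i` is closed `y` is pendant at `u_j` and invisible (`patCount_close_*`). So

* `B(p₁) = N(G; s_i of type 1, s_j open)` (**`Bone_01_eq_typedCount`**, `Bone_02_…`, `Bone_12_…`);
* `B(p₂) = N(G; s_i of type 2, s_j open)` (`StarPairs.lean`);
* `B(p₁, q₁) = N(G; the two other star edges of type 1, the shared one open)`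
  (**`Btwo_01_02_eq_typedCount`**, `Btwo_01_12_…`, `Btwo_02_12_…`).

Consequently every pair-block object of the debt identities (`star_212`, `star_122`:
`B(01₁,02₁)`, `B(02₂)`, `B(02₁,12₁)`, …) is an instance of the GRAPH row 2′TRI on a minor of `G`
(`G` itself, unmarked vertices allowed); the only one-rung objects that are not are those with
the triple block `T` (`B(T₁)`, `B(T₂)`, `E(T;p) = B(p₁,T₁) − B(T₁)`, `Λ(01;02;12)`). Identities only.
-/

namespace Summit.Ventures.PercRepro2

open CovForm CovForm.OneTyped CovForm.TypedRed

namespace StarPattern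

section Pairs

variable {V : Type*} {E : Type*} [Fintype E] [DecidableEq E] {R : Type*} [Field R]
  {ends : E → Sym2 V} {o a₁ a₂ a₃ b : V} {s₁ s₂ s₃ : E} {y u₁ u₂ u₃ : V} {F₀ : Finset E}
  {z₀ : Config E}

omit [Fintype E] in
/-- `x[s₂ ↦ open][s₁ ↦ a]` with `x s₃ = false` is the star pattern `(a, true, false)`. -/
lemma update_21_eq_starSet (h12 : s₁ ≠ s₂) (h13 : s₁ ≠ s₃) (h23 : s₂ ≠ s₃) (a : Bool)
    {x : Config E} (hx : x s₃ = false) :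
    Function.update (Function.update x s₂ true) s₁ a = starSet s₁ s₂ s₃ (a, true, false) x := by
  funext g
  rw [starSet_apply h12 h13 h23]
  simp only [Function.update_apply]
  split_ifs <;> simp_all

/-- One placement term with `s₂` pinned open and `s₁` placed as `(a, b, c)`. -/
lemma pinned_term_21 (D : StarData ends o a₁ a₂ a₃ b s₁ s₂ s₃ y u₁ u₂ u₃ F₀ z₀)
    (τ : E → ℕ) (hz₁ : z₀ s₁ = false) (hz₂ : z₀ s₂ = false) (hz₃ : z₀ s₃ = false) (t : ℕ)
    (a b' c : Bool) :
    typedCount F₀ (Function.update (Function.update z₀ s₂ true) s₁ false) (Function.update τ s₁ t)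
        (fun x y w => (K3 ends o a₁ a₂ a₃ b : Config E → Config E → Config E → R)
          (Function.update x s₁ a) (Function.update y s₁ b') (Function.update w s₁ c)) =
      patCount ends o a₁ a₂ a₃ b s₁ s₂ s₃ F₀ z₀ τ (a, true, false) (b', true, false) (c, true,
        false) := by
  rw [typedCount_congr_τ F₀ _ (τ' := τ) (fun e he => Function.update_of_ne
    (ne_of_mem_of_not_mem he D.hF₁) _ _)]
  rw [typedCount_repin_false F₀ s₂ D.hF₂]
  have hzj : Function.update (Function.update z₀ s₂ true) s₁ false s₂ = true := by
    rw [Function.update_of_ne D.h12.symm, Function.update_self]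
  rw [hzj]
  have hz : Function.update (Function.update (Function.update z₀ s₂ true) s₁ false) s₂ false
      = z₀ := by
    funext g
    simp only [Function.update_apply]
    split_ifs <;> simp_all
  rw [hz]
  unfold patCount patKernel
  refine typedCount_congr_on F₀ z₀ τ fun x y w hpin _ => ?_
  have hx : x s₃ = false := ((hpin s₃ D.hF₃).1).trans hz₃
  have hy : y s₃ = false := ((hpin s₃ D.hF₃).2.1).trans hz₃
  have hw : w s₃ = false := ((hpin s₃ D.hF₃).2.2).trans hz₃
  rw [update_21_eq_starSet D.h12 D.h13 D.h23 a hx, update_21_eq_starSet D.h12 D.h13 D.h23 b' hy,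
    update_21_eq_starSet D.h12 D.h13 D.h23 c hw]

/-- **The pair base `B(01₁)` is a typed count of the graph**: `s₂` pinned open, `s₁` of type `1`. -/
theorem Bone_01_eq_typedCount (D : StarData ends o a₁ a₂ a₃ b s₁ s₂ s₃ y u₁ u₂ u₃ F₀ z₀)
    (τ : E → ℕ) (hz₁ : z₀ s₁ = false) (hz₂ : z₀ s₂ = false) (hz₃ : z₀ s₃ = false) :
    typedCount (insert s₁ F₀) (Function.update z₀ s₂ true) (Function.update τ s₁ 1)
        (K3 ends o a₁ a₂ a₃ b : Config E → Config E → Config E → R) =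
      Bone ends o a₁ a₂ a₃ b s₁ s₂ s₃ F₀ z₀ τ (true, true, false) := by
  rw [typedCount_split (insert s₁ F₀) s₁ (Finset.mem_insert_self _ _)]
  simp only [Function.update_self, Finset.erase_insert D.hF₁, sum_bool3_one]
  rw [pinned_term_21 D τ hz₁ hz₂ hz₃, pinned_term_21 D τ hz₁ hz₂ hz₃,
    pinned_term_21 D τ hz₁ hz₂ hz₃]
  rw [patCount_close_y D τ _ (Or.inr (Or.inl rfl)), patCount_close_w D τ _ _ (Or.inr (Or.inl rfl)),
    patCount_close_x D τ (Or.inr (Or.inl rfl)), patCount_close_w D τ _ _ (Or.inr (Or.inl rfl)),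
    patCount_close_x D τ (Or.inr (Or.inl rfl)), patCount_close_y D τ _ (Or.inr (Or.inl rfl))]
  unfold Bone
  ring

omit [Fintype E] in
/-- `x[s₃ ↦ open][s₁ ↦ a]` with `x s₂ = false` is the star pattern `(a, false, true)`. -/
lemma update_31_eq_starSet (h12 : s₁ ≠ s₂) (h13 : s₁ ≠ s₃) (h23 : s₂ ≠ s₃) (a : Bool)
    {x : Config E} (hx : x s₂ = false) :
    Function.update (Function.update x s₃ true) s₁ a = starSet s₁ s₂ s₃ (a, false, true) x := by
  funext g
  rw [starSet_apply h12 h13 h23]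
  simp only [Function.update_apply]
  split_ifs <;> simp_all

/-- One placement term with `s₃` pinned open and `s₁` placed as `(a, b, c)`. -/
lemma pinned_term_31 (D : StarData ends o a₁ a₂ a₃ b s₁ s₂ s₃ y u₁ u₂ u₃ F₀ z₀)
    (τ : E → ℕ) (hz₁ : z₀ s₁ = false) (hz₂ : z₀ s₂ = false) (hz₃ : z₀ s₃ = false) (t : ℕ)
    (a b' c : Bool) :
    typedCount F₀ (Function.update (Function.update z₀ s₃ true) s₁ false) (Function.update τ s₁ t)
        (fun x y w => (K3 ends o a₁ a₂ a₃ b : Config E → Config E → Config E → R)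
          (Function.update x s₁ a) (Function.update y s₁ b') (Function.update w s₁ c)) =
      patCount ends o a₁ a₂ a₃ b s₁ s₂ s₃ F₀ z₀ τ (a, false, true) (b', false, true) (c, false,
        true) := by
  rw [typedCount_congr_τ F₀ _ (τ' := τ) (fun e he => Function.update_of_ne
    (ne_of_mem_of_not_mem he D.hF₁) _ _)]
  rw [typedCount_repin_false F₀ s₃ D.hF₃]
  have hzj : Function.update (Function.update z₀ s₃ true) s₁ false s₃ = true := by
    rw [Function.update_of_ne D.h13.symm, Function.update_self]
  rw [hzj]
  have hz : Function.update (Function.update (Function.update z₀ s₃ true) s₁ false) s₃ false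
      = z₀ := by
    funext g
    simp only [Function.update_apply]
    split_ifs <;> simp_all
  rw [hz]
  unfold patCount patKernel
  refine typedCount_congr_on F₀ z₀ τ fun x y w hpin _ => ?_
  have hx : x s₂ = false := ((hpin s₂ D.hF₂).1).trans hz₂
  have hy : y s₂ = false := ((hpin s₂ D.hF₂).2.1).trans hz₂
  have hw : w s₂ = false := ((hpin s₂ D.hF₂).2.2).trans hz₂
  rw [update_31_eq_starSet D.h12 D.h13 D.h23 a hx, update_31_eq_starSet D.h12 D.h13 D.h23 b' hy,
    update_31_eq_starSet D.h12 D.h13 D.h23 c hw]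

/-- **The pair base `B(02₁)` is a typed count of the graph**: `s₃` pinned open, `s₁` of type `1`. -/
theorem Bone_02_eq_typedCount (D : StarData ends o a₁ a₂ a₃ b s₁ s₂ s₃ y u₁ u₂ u₃ F₀ z₀)
    (τ : E → ℕ) (hz₁ : z₀ s₁ = false) (hz₂ : z₀ s₂ = false) (hz₃ : z₀ s₃ = false) :
    typedCount (insert s₁ F₀) (Function.update z₀ s₃ true) (Function.update τ s₁ 1)
        (K3 ends o a₁ a₂ a₃ b : Config E → Config E → Config E → R) =
      Bone ends o a₁ a₂ a₃ b s₁ s₂ s₃ F₀ z₀ τ (true, false, true) := by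
  rw [typedCount_split (insert s₁ F₀) s₁ (Finset.mem_insert_self _ _)]
  simp only [Function.update_self, Finset.erase_insert D.hF₁, sum_bool3_one]
  rw [pinned_term_31 D τ hz₁ hz₂ hz₃, pinned_term_31 D τ hz₁ hz₂ hz₃,
    pinned_term_31 D τ hz₁ hz₂ hz₃]
  rw [patCount_close_y D τ _ (Or.inr (Or.inr rfl)), patCount_close_w D τ _ _ (Or.inr (Or.inr rfl)),
    patCount_close_x D τ (Or.inr (Or.inr rfl)), patCount_close_w D τ _ _ (Or.inr (Or.inr rfl)),
    patCount_close_x D τ (Or.inr (Or.inr rfl)), patCount_close_y D τ _ (Or.inr (Or.inr rfl))]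
  unfold Bone
  ring

omit [Fintype E] in
/-- `x[s₃ ↦ open][s₂ ↦ a]` with `x s₁ = false` is the star pattern `(false, a, true)`. -/
lemma update_32_eq_starSet (h12 : s₁ ≠ s₂) (h13 : s₁ ≠ s₃) (h23 : s₂ ≠ s₃) (a : Bool)
    {x : Config E} (hx : x s₁ = false) :
    Function.update (Function.update x s₃ true) s₂ a = starSet s₁ s₂ s₃ (false, a, true) x := by
  funext g
  rw [starSet_apply h12 h13 h23]
  simp only [Function.update_apply]
  split_ifs <;> simp_all

/-- One placement term with `s₃` pinned open and `s₂` placed as `(a, b, c)`. -/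
lemma pinned_term_32 (D : StarData ends o a₁ a₂ a₃ b s₁ s₂ s₃ y u₁ u₂ u₃ F₀ z₀)
    (τ : E → ℕ) (hz₁ : z₀ s₁ = false) (hz₂ : z₀ s₂ = false) (hz₃ : z₀ s₃ = false) (t : ℕ)
    (a b' c : Bool) :
    typedCount F₀ (Function.update (Function.update z₀ s₃ true) s₂ false) (Function.update τ s₂ t)
        (fun x y w => (K3 ends o a₁ a₂ a₃ b : Config E → Config E → Config E → R)
          (Function.update x s₂ a) (Function.update y s₂ b') (Function.update w s₂ c)) =
      patCount ends o a₁ a₂ a₃ b s₁ s₂ s₃ F₀ z₀ τ (false, a, true) (false, b', true)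
        (false, c, true) := by
  rw [typedCount_congr_τ F₀ _ (τ' := τ) (fun e he => Function.update_of_ne
    (ne_of_mem_of_not_mem he D.hF₂) _ _)]
  rw [typedCount_repin_false F₀ s₃ D.hF₃]
  have hzj : Function.update (Function.update z₀ s₃ true) s₂ false s₃ = true := by
    rw [Function.update_of_ne D.h23.symm, Function.update_self]
  rw [hzj]
  have hz : Function.update (Function.update (Function.update z₀ s₃ true) s₂ false) s₃ false
      = z₀ := by
    funext g
    simp only [Function.update_apply]
    split_ifs <;> simp_all
  rw [hz]
  unfold patCount patKernel
  refine typedCount_congr_on F₀ z₀ τ fun x y w hpin _ => ?_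
  have hx : x s₁ = false := ((hpin s₁ D.hF₁).1).trans hz₁
  have hy : y s₁ = false := ((hpin s₁ D.hF₁).2.1).trans hz₁
  have hw : w s₁ = false := ((hpin s₁ D.hF₁).2.2).trans hz₁
  rw [update_32_eq_starSet D.h12 D.h13 D.h23 a hx, update_32_eq_starSet D.h12 D.h13 D.h23 b' hy,
    update_32_eq_starSet D.h12 D.h13 D.h23 c hw]

/-- **The pair base `B(12₁)` is a typed count of the graph**: `s₃` pinned open, `s₂` of type `1`. -/
theorem Bone_12_eq_typedCount (D : StarData ends o a₁ a₂ a₃ b s₁ s₂ s₃ y u₁ u₂ u₃ F₀ z₀)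
    (τ : E → ℕ) (hz₁ : z₀ s₁ = false) (hz₂ : z₀ s₂ = false) (hz₃ : z₀ s₃ = false) :
    typedCount (insert s₂ F₀) (Function.update z₀ s₃ true) (Function.update τ s₂ 1)
        (K3 ends o a₁ a₂ a₃ b : Config E → Config E → Config E → R) =
      Bone ends o a₁ a₂ a₃ b s₁ s₂ s₃ F₀ z₀ τ (false, true, true) := by
  rw [typedCount_split (insert s₂ F₀) s₂ (Finset.mem_insert_self _ _)]
  simp only [Function.update_self, Finset.erase_insert D.hF₂, sum_bool3_one]
  rw [pinned_term_32 D τ hz₁ hz₂ hz₃, pinned_term_32 D τ hz₁ hz₂ hz₃,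
    pinned_term_32 D τ hz₁ hz₂ hz₃]
  rw [patCount_close_y D τ _ (Or.inr (Or.inr rfl)), patCount_close_w D τ _ _ (Or.inr (Or.inr rfl)),
    patCount_close_x D τ (Or.inr (Or.inr rfl)), patCount_close_w D τ _ _ (Or.inr (Or.inr rfl)),
    patCount_close_x D τ (Or.inr (Or.inr rfl)), patCount_close_y D τ _ (Or.inr (Or.inr rfl))]
  unfold Bone
  ring

end Pairs

end StarPattern

end Summit.Ventures.PercRepro2
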